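import Summits.QuantumFields.YangMills.Theorems.BalabanUVNodesK0AxJunctionWindow
import Summits.QuantumFields.YangMills.Theorems.BalabanUVNodesK0AxJoinResidual

/-!
# P3 g91 №18 — THE BOX ROAD AT COFINAL RADII, COMPOSED WITH THE JOIN-RESIDUAL CENSUS: K0ᴬ and the junction keyed to {⁸-on-the-box, (R-Uk), (R-Bg), (R-Tok), (C-orb)♭} — LENS P3 «weaken the target»

LANDING NOTE (porter ▶ PTC-1 g4, 2026-08-31; AUTHORSHIP = ★ P3 g91 «weaken the target», HOME sketch `nodeO-cover/P3-JoinResidualBox-v1.lean` sha16 82b3808733d94015 · 253 l. · 6 thm, no `def`, 0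
sorry (№18: `JoinAntecedentsCofinal` taken OFF the K0ᴬ box-road and junction displays — replaced by the three residual receipts (R-Uk)∕(R-Bg)∕(R-Tok) in ceiling-and-floor shape, 10∕13 JOIN rows
being TREE theorems on cofinally small radii; radius-first antecedent supply `joinAntecedentsRadiusFirst_of_residual`)): landed VERBATIM (only this paragraph added) under P3's basename
(`…Theorems/BalabanUVNodesK0AxJoinResidualBox.lean`, ns `…Theorems.K0AxJoinResidualBox`) as INTENT-68; imports ✓p822992 `…K0AxJunctionWindow` + ✓p812183 `…K0AxJoinResidual`; `--supports
stmt-QuantumFields-27238 --as helper` (NO `--workitem`; kind proof); ◆ CRIT-1 g38's cut (nodeO STATUS 2026-08-31T12:42:14Z): «GO VERBATIM; farm rc 0 · 0 warn · 0 sorry, axioms std guarded on all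
6, dedup 6∕6 + ns fresh; VERBATIM CLAIMS CHECKED MECHANICALLY — `hUk`∕`hBg`∕`hTok` string-equal to ✓`…K0AxJoinResidual`'s cut binders (no silent re-signing); J5′ PASS; J1′ + (Q-ord) LEGAL (radius
chosen BEFORE `Mth`, P3's circularity note right); RATE-LEVER ∕ SAME-WALL: SURVIVES (LENS P3 proper — a displayed hypothesis WEAKENED, conclusions unchanged); ONE priced repair road (not a
condition): the two remaining bare-∀-radius binders `hOrb`∕`hWin`».  HONEST (porter): CONDITIONAL doors over DISPLAYED letters inhabited NOWHERE (⁸ ∕ cofinal ⁸, (R-Uk), (R-Bg), (R-Tok), (C-orb)♭,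
window letters); nothing of Bałaban asserted, ported, discharged or refuted; K0ᴬ stmt-QuantumFields-27238 ∕ K1ᴬ 27239 OPEN — NOTHING of them proved; NODE O 0∕1; COUNT 8∕28 · K 1∕4 UNMOVED; finite
𝕋⁴ at fixed ε — NOT continuum ∕ OS ∕ Clay; the Yang–Mills mass gap is NOT proved by any of this.

ym-nodeO-ideate ★ P3 g91 (count-neutral author seat; sketch OFFERED to ◆ CRIT-1 ∕ ▶ PTC-1 — P3 files nothing).  WHAT THIS FILE DOES, exactly.  After №16 (✓`…K0AxChartRowsOfOrbit`) and №17
(✓`…K0AxJunctionWindow`) both consumers of NODE-O-type content on the BOX road — K0ᴬ `Record13SepCoPHInhabitedAx` and the n24 junction's binder `hβc` — are keyed to the displayed triple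
{⁸ `Sig8LR4Box` (resp. the cofinal ⁸ `∀ εw > 0, Sig8LR4BoxBelow F εw`), `JoinAntecedentsCofinal Tok F`, (C-orb)♭} (+ the two window letters for the junction).  The middle item — ▶ PTC-1's
supply shape «the JOIN's thirteen antecedents at EVERY radius `a₀ > 0`, cofinally in `Mc`» — is inhabited NOWHERE and, AT EVERY RADIUS, cannot be: its (8)ᴮ-type members are theorems only
BELOW a family radius `aS(F)` (stub 1ᴮ ✓`K0Stub1BHolds.prop8StepCoPGridGBAt_holds`).  ★ P3 g88's census ✓`…K0AxJoinResidual` (landed by ▶ PTC-1 g3) typed the repair on the W-UDR road: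
on COFINALLY SMALL radii TEN of the thirteen rows are TREE THEOREMS and the residual is three print receipts — (R-Uk) [15] Thm 1's existence ∕ unique-orbit clause for the record's `U_k`,
(R-Bg) real-analyticity at `B = 0` of the record's background field ([15] Prop. 9), (R-Tok) the locality token — each below ITS OWN radius ceiling and above its own cut-off floor in `Mc`
(✓`joinAntecedentsCofinalRadii_of_residual`).  THIS FILE CARRIES THAT CENSUS ONTO THE BOX ROAD (LENS P3 proper: the displayed hypothesis WEAKENED from «every radius» to «cofinally small
radii», same conclusions, then the ten theorem-rows deleted):
§1 ★★ `record13SepCoPHInhabitedAx_of_sig8LR4Box_antecedentsCofinalRadii_orb` — K0ᴬ BY NAME ⟸ ⁸-on-the-box ∧ `JoinAntecedentsCofinalRadii Tok F` (g88's COFINAL-RADII shape, ✓`…PortHRecordJoinToDoor`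
   §6) ∧ (C-orb)♭: №16 §2′'s proof with the radius `a₀ ≤ a` supplied by the JOIN instead of `a₀ := a` (the target door ✓`record13SepCoPHInhabitedAx_of_chartRowsBox_cofinalRadii` already reads
   cofinal radii; rows by ✓`chartRowsBox_of_orbit` from (C-orb)♭ + antecedent (12));
§2 ★★★ `record13SepCoPHInhabitedAx_of_sig8LR4Box_residual_orb` — §1 ∘ ✓g88 §3: **K0ᴬ BY NAME ⟸ ⁸-on-the-box ∧ (R-Uk) ∧ (R-Bg) ∧ (R-Tok) ∧ (C-orb)♭** — the box road's twin of ✓g88 §4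
   `record13SepCoPHInhabitedAx_of_texts_residual` WITHOUT the ⁷-shaped text, WITHOUT the (1.21)-Ax run letter `h121`, WITHOUT chart rows;
§3 ★ `joinAntecedentsRadiusFirst_of_residual` — the RADIUS-FIRST supply «∀ a > 0, ∃ a₀ ∈ ]0,a], ∀ Mth, ∃ Mc ≥ Mth, ∃ j…a₁, JoinAntecedents … a₀ a₁» from the same three receipts: ✓g88 §3's
   proof REORDERED (its radius `a₀ := min(a, aS, aU, aB, aT)` never depended on `Mth`) — the shape the junction needs, because the window `(εw, γw)` is read AT the radius and ⁸-below's
   threshold `Mth` depends on `εw`; `joinAntecedentsCofinalRadii_of_radiusFirst` (radius-first ⟹ g88's shape, bookkeeping);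
§4 ★★ `cofinalBetaSocketAxBody_allRadii_of_sig8LR4BoxCofinal_radiusFirst_orb_window` — the junction's binder `hβc` VERBATIM ⟸ cofinal ⁸ ∧ the radius-first supply ∧ (C-orb)♭ ∧ the two
   window letters (№17 §2's proof at the supplied radius `a₀ ≤ a`: window at `a₀` → ⁸-below at `εw` → the supply at ⁸'s threshold → rows → ✓№10 at level `min γ₀ (min γw ½)`, `Mg := 4·Mc`);
§5 ★★★ `cofinalBetaSocketAxBody_allRadii_of_sig8LR4BoxCofinal_residual_orb_window` — §4 ∘ §3: **`hβc` ⟸ cofinal ⁸ ∧ (R-Uk) ∧ (R-Bg) ∧ (R-Tok) ∧ (C-orb)♭ ∧ the window letters.**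
EDGE CONTENT (LENS-P3 decision table, box road): `JoinAntecedentsCofinal` (13 rows, inhabited nowhere, unprovable at every radius) is OFF both displays; in its place THREE print receipts
with radius ceilings and `Mc` floors, the other TEN rows being tree theorems (stub 1ᴮ, [6] Prop. 6 ⟹ Gauge 9, (8)ᴮ ⟹ [15] Thm 1, `McGuard` at `Mc := L^e`).  K0ᴬ's box-road residue =
{⁸-on-the-box, (R-Uk), (R-Bg), (R-Tok), (C-orb)♭}; the junction's = the same with the cofinal ⁸ + {Hessian row, sign letter} in the window.

HONEST FRAMING.  CONDITIONAL doors (kernel-checked implications between DISPLAYED rows; audit `proof.conditional` ∕ support, credits nothing); NOTHING of Bałaban is asserted, ported,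
discharged or refuted here beyond what the cited tree theorems already prove; ⁸'s box texts are CANDIDATE texts signed NOWHERE; (R-Uk) ∕ (R-Bg) ∕ (R-Tok) ∕ (C-orb)♭ ∕ the window letters are
OPEN Bałaban-strength content ([15] Thm 1, Prop. 9; [I] (4.35); [I] §1∕§5 + AF sign); K0ᴬ stmt-QuantumFields-27238 OPEN — NOTHING of it proved; K1ᴬ 27239 ∕ K3ᴬ 27247 ∕ ⟨27930⟩ OPEN;
NODE O `B13TermWalkDataOneTorus.ExistsUniformAcrossSmall` NOT inhabited (0∕1); COUNT 8∕28 · K 1∕4 UNMOVED; finite `𝕋⁴_{L^K}` at fixed ε — NOT continuum ∕ ℝ⁴ ∕ OS; R4 = the conditional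
`BalabanLadder.UV` rung only; **the Yang–Mills mass gap (Clay) is NOT proved by any of this.**  No `sorry`, no `def`, no `instance`, no `notation`; standard axioms.

References: T. Bałaban, *Renormalization group approach to lattice gauge field theories. I*, Comm. Math. Phys. 109 (1987) 249–301 [Balaban1987RG1] — Thm 1 p.259, Thm 2 (0.31) p.259,
Thm 3 p.264, (1.18)–(1.22) pp.263–264, (4.35)–(4.37) pp.290–291, (5.10) p.293, (5.38)–(5.44) pp.296–297; T. Bałaban, *The variational problem and background fields in renormalization
group method for lattice gauge theories*, Comm. Math. Phys. 102 (1985) 277–309 [Balaban1985Variational] — Thm 1 (8)–(9) p.279, Prop. 6 p.295, Prop. 9 p.309, (176)–(178) p.306;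
T. Bałaban, *Propagators for lattice gauge theories in a background field*, Comm. Math. Phys. 99 (1985) 389–434 [Balaban1985PropagatorsBG] — (8) p.392.
-/

open Filter Topology
open scoped BigOperators Matrix.Norms.L2Operator

namespace Summit.QuantumFields.YangMills.Theorems.K0AxJoinResidualBox

open Literature.MathematicalPhysics.QuantumFieldTheory.Balaban1983to89
open Literature.MathematicalPhysics.QuantumFieldTheory.Balaban1983to89.Node00
open Literature.MathematicalPhysics.QuantumFieldTheory.Balaban1983to89.T4Continuum (T4Family)
open Literature.MathematicalPhysics.QuantumFieldTheory.Balaban1983to89.B12FormatPlus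
open Literature.MathematicalPhysics.QuantumFieldTheory.Balaban1983to89.FlowStep
open Literature.MathematicalPhysics.QuantumFieldTheory.Balaban1983to89.FlowStepRuns
open Summit.QuantumFields.YangMills.Theorems
open Summit.QuantumFields.YangMills.Theorems.K0RecordFormatNames
open Summit.QuantumFields.YangMills.Theorems.K0AxMomentRoad
open Summit.QuantumFields.YangMills.Theorems.PortHRecordJoin
open Summit.QuantumFields.YangMills.Theorems.BalabanUVNodesPortS1 (Sig8LR4Box)
open Summit.QuantumFields.YangMills.Theorems.K0AxChartRowsOfOrbit (chartRowsBox_of_orbit)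
open Summit.QuantumFields.YangMills.Theorems.K0AxJunctionWindow (Sig8LR4BoxBelow)
open Summit.QuantumFields.YangMills.Theorems.K0AxJoinResidual (joinAntecedentsCofinalRadii_of_residual)
open Summit.QuantumFields.YangMills.Theorems.K0V23Stub3CofinalRunDoorAx (twoPrimeAx)
open Summit.QuantumFields.YangMills.BalabanUVNodes.K0Stub1BHolds (prop8StepCoPGridGBAt_holds)
open Summit.QuantumFields.YangMills.BalabanUVNodes.N07Thm1Top7FromProp8GuardedB (variationalThm1RegSepCoP7MGB_of_prop8TopStepGB_lamDatum)
open Summit.QuantumFields.YangMills.Theorems.K0PrintCubeOfStepTokensGridGuardedB (gauge9SupplierG3B_of_prop6MemberP)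

/-! ## §1  ★★ K0ᴬ BY NAME ⟸ ⁸-on-the-box ∧ the JOIN's antecedents at COFINALLY SMALL radii ∧ (C-orb)♭ -/

/-- ★★ **K0ᴬ BY NAME FROM ⁸-ON-THE-BOX + THE JOIN's ANTECEDENTS AT COFINALLY SMALL RADII + (C-orb)♭** — №16 §2′ ✓`record13SepCoPHInhabitedAx_of_sig8LR4Box_antecedents_orb` with its displayed
supply `JoinAntecedentsCofinal Tok F` (every radius) WEAKENED to ★ P3 g88's `JoinAntecedentsCofinalRadii Tok F` (some radius `a₀ ∈ ]0, a]` below every ceiling): for the ceiling `a`, ⁸'s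
threshold `Mth`, the JOIN's radius `a₀ ≤ a` and letter `Mc ≥ Mth`, ⁸-on-the-box yields D1 at every box history of some level, §1 of №16 yields the chart rows from (C-orb)♭ and antecedent (12),
and ✓`record13SepCoPHInhabitedAx_of_chartRowsBox_cofinalRadii` (which reads cofinal radii) closes at `a₀`, level `min γ₀ ½`, `Mg := 4·Mc`.  CONDITIONAL door; every hypothesis OPEN (⁸'s box
text signed nowhere; the supply inhabited only from the three receipts of §2; (C-orb)♭ = P0's territory); K0ᴬ 27238 OPEN; the Yang–Mills mass gap is NOT proved.
[cite: Balaban1987RG1, Thm 1 p.259, Thm 3 p.264, (1.18)–(1.22) pp.263–264, (4.35)–(4.37) pp.290–291, (5.10) p.293; Balaban1985Variational, Thm 1 p.279, Prop. 9 p.309, (176)–(178) p.306] -/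
theorem record13SepCoPHInhabitedAx_of_sig8LR4Box_antecedentsCofinalRadii_orb (Tok : T4Family → ℕ → ℝ → Prop)
    (hBr : ∀ (F : T4Family) (Mc : ℕ) (a₀ : ℝ), Tok F Mc a₀ → TokP9L4Old F Mc a₀)
    (h8 : ∀ F, Sig8LR4Box F) (hA : ∀ F, JoinAntecedentsCofinalRadii Tok F)
    (hOrb : ∀ (F : T4Family) (Mc : ℕ) (a₀ ε₂₉ : ℝ), McGuard F Mc → 0 < a₀ → 0 < ε₂₉ →
      letI θ := thetaFill F a₀ ε₂₉; letI := θ.instVβ₁; letI := θ.instVβ₂; letI := θ.instιβ;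
      (∀ (k n : ℕ) (a : θ.ιβ) (l : RespLabel F k (recordK₀ F Mc k + n)), RootedResponseOrbitAt F θ k (recordK₀ F Mc k + n) a l)) :
    Summit.QuantumFields.YangMills.Theses.BalabanUVNodes.Record13SepCoPHInhabitedAx := by
  refine record13SepCoPHInhabitedAx_of_chartRowsBox_cofinalRadii fun F a ha => ?_
  obtain ⟨Mth, h8F⟩ := h8 F
  obtain ⟨a₀, ha₀', hle, Mc, hMc, j, c, c₀, c₁, B₃, B₃', a₁, hAnt⟩ := hA F Mth a ha
  obtain ⟨hG0, hc, hc₀, hc₁, hB₃, hB₃', ha₀, ha₁, hThm, hGauge, hUk, hBg, hP9⟩ := hAnt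
  obtain ⟨γ₀, ε₂₉, E₀, κ, α₀, α₁, hγ₀, hε, hE₀, hκ, hα₀, hα₁, hD⟩ :=
    h8F Mc hMc j c c₀ c₁ B₃ B₃' a₀ a₁ hG0 hc hc₀ hc₁ hB₃ hB₃' ha₀ ha₁ hThm hGauge hUk hBg (hBr F Mc a₀ hP9)
  letI θ := thetaFill F a₀ ε₂₉; letI := θ.instVβ₁; letI := θ.instVβ₂; letI := θ.instιβ
  obtain ⟨ιC, hsw, h9⟩ := chartRowsBox_of_orbit F Mc a₀ ε₂₉ ha₀ (hOrb F Mc a₀ ε₂₉ hG0 ha₀ hε) fun k n => (hBg k n ε₂₉ hε).contDiffAt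
  refine ⟨a₀, ha₀, hle, min γ₀ (1 / 2), ε₂₉, E₀, κ, 4 * (Mc : ℝ), α₀, α₁, Mc, lt_min hγ₀ (by norm_num), min_le_right _ _, hε, hE₀, hκ,
    hα₀, hα₁, hG0, le_rfl, ιC, fun k v hv => hD k v ?_, hsw, h9⟩
  exact mem_box.mpr fun i => ⟨(mem_box.mp hv i).1, (mem_box.mp hv i).2.trans (min_le_left _ _)⟩

/-! ## §2  ★★★ K0ᴬ BY NAME ⟸ ⁸-on-the-box ∧ (R-Uk) ∧ (R-Bg) ∧ (R-Tok) ∧ (C-orb)♭ — TEN of the JOIN's thirteen rows DISCHARGED on the box road -/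

/-- ★★★ **K0ᴬ BY NAME FROM ⁸-ON-THE-BOX + THE THREE RESIDUAL RECEIPTS + (C-orb)♭** (§1 ∘ ✓`K0AxJoinResidual.joinAntecedentsCofinalRadii_of_residual`): for every token `Tok` with `Tok ⟹ TokP9L4Old`,
⁸'s box edition ∧ (R-Uk) [15] Thm 1's existence ∕ unique-orbit clause for the record's `U_k` below a radius ceiling `aU(F)` and above a floor `M₀` in `Mc` ∧ (R-Bg) real-analyticity at `B = 0`
of the record's background field below `aB(F)`, above its floor ∧ (R-Tok) the locality token below `aT(F)`, above its floor ∧ (C-orb)♭ ⟹ `Record13SepCoPHInhabitedAx` — the other TEN JOIN rows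
(`McGuard` at `Mc := L^e`; the grid letters; `2L² ≤ B₃`, `0 < B₉`, `0 < a₀ ≤ aS(F)`, `0 < a₁'`; Gauge 9 from [6] Prop. 6; [15] Thm 1's (7)-regularity from (8)ᴮ) being TREE THEOREMS on cofinally
small radii (✓g88 §3, verbatim the discharge lines of ✓p810573).  The BOX road's twin of ✓g88 §4 `record13SepCoPHInhabitedAx_of_texts_residual`: NO ⁷-shaped text, NO (1.21)-Ax run letter,
NO chart row.  CONDITIONAL helper; every displayed hypothesis OPEN Bałaban-strength content; K0ᴬ OPEN; nothing of Bałaban discharged beyond the cited theorems; the mass gap is NOT proved.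
[cite: Balaban1987RG1, Thm 1 p.259, Thm 3 p.264, (1.18)–(1.22) pp.263–264, (4.35)–(4.37) pp.290–291, (5.10) p.293; Balaban1985Variational, Thm 1 (8)–(9) p.279, Prop. 6 p.295, Prop. 9 p.309,
(176)–(178) p.306] -/
theorem record13SepCoPHInhabitedAx_of_sig8LR4Box_residual_orb (Tok : T4Family → ℕ → ℝ → Prop)
    (hBr : ∀ (F : T4Family) (Mc : ℕ) (a₀ : ℝ), Tok F Mc a₀ → TokP9L4Old F Mc a₀)
    (h8 : ∀ F, Sig8LR4Box F)
    (hUk : ∀ F : T4Family, ∃ aU : ℝ, 0 < aU ∧ ∀ (B₃ a₀ a₁ : ℝ), 2 * (F.L : ℝ) ^ 2 ≤ B₃ → 0 < a₀ → a₀ ≤ aU → 0 < a₁ → ∃ M₀ : ℕ, ∀ Mc : ℕ, McGuard F Mc → M₀ ≤ Mc →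
      (∀ ε₁ : ℝ, 0 < ε₁ → ε₁ ≤ a₁ → B₃ * ε₁ ≤ a₀ → ∀ (k n : ℕ) (V : Literature.MathematicalPhysics.QuantumFieldTheory.Balaban1983to89.GaugeField (F.P (Summit.QuantumFields.YangMills.Theorems.K0RecordFormatNames.recordK₀ F Mc k + n)) (k + 1) (Literature.MathematicalPhysics.QuantumFieldTheory.Balaban1983to89.Node00.SU 2)), Literature.MathematicalPhysics.QuantumFieldTheory.Balaban1983to89.PlaqSmall ε₁ V → Literature.MathematicalPhysics.QuantumFieldTheory.Balaban1983to89.Node00.UkExists F 2 (Summit.QuantumFields.YangMills.Theorems.K0RecordFormatNames.recordK₀ F Mc k + n) (k + 1) a₀ V ∧ Literature.MathematicalPhysics.QuantumFieldTheory.Balaban1983to89.Node00.UniqueUkOrbit F 2 (Summit.QuantumFields.YangMills.Theorems.K0RecordFormatNames.recordK₀ F Mc k + n) (k + 1) a₀ V))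
    (hBg : ∀ F : T4Family, ∃ aB : ℝ, 0 < aB ∧ ∀ a₀ : ℝ, 0 < a₀ → a₀ ≤ aB → ∃ M₀ : ℕ, ∀ Mc : ℕ, McGuard F Mc → M₀ ≤ Mc →
      (∀ (k n : ℕ) (ε₂₉ : ℝ), 0 < ε₂₉ → letI θ := Summit.QuantumFields.YangMills.Theorems.K0RecordFormatNames.thetaFill F a₀ ε₂₉; letI := θ.instVβ₁; letI := θ.instVβ₂; letI := θ.instιβ; AnalyticAt ℝ (fun B : Summit.QuantumFields.YangMills.Theorems.K0RecordFormatNames.recordW F a₀ ε₂₉ k (Summit.QuantumFields.YangMills.Theorems.K0RecordFormatNames.recordK₀ F Mc k + n) => fun (b : Literature.MathematicalPhysics.QuantumFieldTheory.Balaban1983to89.PBond (F.P (Summit.QuantumFields.YangMills.Theorems.K0RecordFormatNames.recordK₀ F Mc k + n)) 0) (i i' : Fin 2) => ((Summit.QuantumFields.YangMills.Theorems.K0RecordFormatNames.recordBgField F θ k (Summit.QuantumFields.YangMills.Theorems.K0RecordFormatNames.recordK₀ F Mc k + n) B b : Literature.MathematicalPhysics.QuantumFieldTheory.Balaban1983to89.Node00.SU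 2) : Matrix (Fin 2) (Fin 2) ℂ) i i') 0))
    (hTok : ∀ F : T4Family, ∃ aT : ℝ, 0 < aT ∧ ∀ a₀ : ℝ, 0 < a₀ → a₀ ≤ aT → ∃ M₀ : ℕ, ∀ Mc : ℕ, McGuard F Mc → M₀ ≤ Mc → Tok F Mc a₀)
    (hOrb : ∀ (F : T4Family) (Mc : ℕ) (a₀ ε₂₉ : ℝ), McGuard F Mc → 0 < a₀ → 0 < ε₂₉ →
      letI θ := thetaFill F a₀ ε₂₉; letI := θ.instVβ₁; letI := θ.instVβ₂; letI := θ.instιβ;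
      (∀ (k n : ℕ) (a : θ.ιβ) (l : RespLabel F k (recordK₀ F Mc k + n)), RootedResponseOrbitAt F θ k (recordK₀ F Mc k + n) a l)) :
    Summit.QuantumFields.YangMills.Theses.BalabanUVNodes.Record13SepCoPHInhabitedAx :=
  record13SepCoPHInhabitedAx_of_sig8LR4Box_antecedentsCofinalRadii_orb Tok hBr h8
    (fun F => joinAntecedentsCofinalRadii_of_residual Tok F (hUk F) (hBg F) (hTok F)) hOrb

/-! ## §3  ★ The RADIUS-FIRST supply from the three receipts (✓g88 §3's proof reordered) -/

/-- ★ **THE RADIUS-FIRST SUPPLY FROM (R-Uk) ∧ (R-Bg) ∧ (R-Tok)**: for every ceiling `a > 0` ONE radius `a₀ := min(a, aS(F), aU, aB, aT) ∈ ]0, a]` such that for EVERY threshold `Mth` the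
JOIN's thirteen antecedents hold at `a₀` and the admissible letter `Mc := L^{max(Mth, M₀ᵁ, M₀ᴮ, M₀ᵀ)} ≥ Mth` — ✓`joinAntecedentsCofinalRadii_of_residual`'s proof with `a₀` chosen BEFORE `Mth`
(it never depended on it).  This is the shape the junction (§4) needs: its window `(εw, γw)` is read at the radius and the cofinal ⁸'s threshold depends on `εw`.  The ten non-residual rows
are discharged by the same tree theorems (stub 1ᴮ ✓`prop8StepCoPGridGBAt_holds`; ✓`gauge9SupplierG3B_of_prop6MemberP` fed by ✓`twoPrimeAx`; ✓`variationalThm1RegSepCoP7MGB_of_prop8TopStepGB_lamDatum`;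
✓`mcGuard_pow`).  CONDITIONAL in the three receipts; nothing else asserted.
[cite: Balaban1985Variational, Thm 1 (8)–(9) p.279, Prop. 6 p.295, Prop. 9 p.309; Balaban1987RG1, (1.19) p.263, (2.3) p.265, (4.35) p.290; Balaban1985PropagatorsBG, (8) p.392] -/
theorem joinAntecedentsRadiusFirst_of_residual (Tok : T4Family → ℕ → ℝ → Prop) (F : T4Family)
    (hUk : ∃ aU : ℝ, 0 < aU ∧ ∀ (B₃ a₀ a₁ : ℝ), 2 * (F.L : ℝ) ^ 2 ≤ B₃ → 0 < a₀ → a₀ ≤ aU → 0 < a₁ → ∃ M₀ : ℕ, ∀ Mc : ℕ, McGuard F Mc → M₀ ≤ Mc →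
      (∀ ε₁ : ℝ, 0 < ε₁ → ε₁ ≤ a₁ → B₃ * ε₁ ≤ a₀ → ∀ (k n : ℕ) (V : Literature.MathematicalPhysics.QuantumFieldTheory.Balaban1983to89.GaugeField (F.P (Summit.QuantumFields.YangMills.Theorems.K0RecordFormatNames.recordK₀ F Mc k + n)) (k + 1) (Literature.MathematicalPhysics.QuantumFieldTheory.Balaban1983to89.Node00.SU 2)), Literature.MathematicalPhysics.QuantumFieldTheory.Balaban1983to89.PlaqSmall ε₁ V → Literature.MathematicalPhysics.QuantumFieldTheory.Balaban1983to89.Node00.UkExists F 2 (Summit.QuantumFields.YangMills.Theorems.K0RecordFormatNames.recordK₀ F Mc k + n) (k + 1) a₀ V ∧ Literature.MathematicalPhysics.QuantumFieldTheory.Balaban1983to89.Node00.UniqueUkOrbit F 2 (Summit.QuantumFields.YangMills.Theorems.K0RecordFormatNames.recordK₀ F Mc k + n) (k + 1) a₀ V))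
    (hBg : ∃ aB : ℝ, 0 < aB ∧ ∀ a₀ : ℝ, 0 < a₀ → a₀ ≤ aB → ∃ M₀ : ℕ, ∀ Mc : ℕ, McGuard F Mc → M₀ ≤ Mc →
      (∀ (k n : ℕ) (ε₂₉ : ℝ), 0 < ε₂₉ → letI θ := Summit.QuantumFields.YangMills.Theorems.K0RecordFormatNames.thetaFill F a₀ ε₂₉; letI := θ.instVβ₁; letI := θ.instVβ₂; letI := θ.instιβ; AnalyticAt ℝ (fun B : Summit.QuantumFields.YangMills.Theorems.K0RecordFormatNames.recordW F a₀ ε₂₉ k (Summit.QuantumFields.YangMills.Theorems.K0RecordFormatNames.recordK₀ F Mc k + n) => fun (b : Literature.MathematicalPhysics.QuantumFieldTheory.Balaban1983to89.PBond (F.P (Summit.QuantumFields.YangMills.Theorems.K0RecordFormatNames.recordK₀ F Mc k + n)) 0) (i i' : Fin 2) => ((Summit.QuantumFields.YangMills.Theorems.K0RecordFormatNames.recordBgField F θ k (Summit.QuantumFields.YangMills.Theorems.K0RecordFormatNames.recordK₀ F Mc k + n) B b : Literature.MathematicalPhysics.QuantumFieldTheory.Balaban1983to89.Node00.SU 2)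 : Matrix (Fin 2) (Fin 2) ℂ) i i') 0))
    (hTok : ∃ aT : ℝ, 0 < aT ∧ ∀ a₀ : ℝ, 0 < a₀ → a₀ ≤ aT → ∃ M₀ : ℕ, ∀ Mc : ℕ, McGuard F Mc → M₀ ≤ Mc → Tok F Mc a₀) :
    ∀ a : ℝ, 0 < a → ∃ a₀ : ℝ, 0 < a₀ ∧ a₀ ≤ a ∧ ∀ Mth : ℕ, ∃ Mc : ℕ, Mth ≤ Mc ∧
      ∃ (j c c₀ c₁ : ℕ) (B₃ B₃' a₁ : ℝ), JoinAntecedents Tok F Mc j c c₀ c₁ B₃ B₃' a₀ a₁ := by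
  obtain ⟨aU, haU, hUk⟩ := hUk
  obtain ⟨aB, haB, hBg⟩ := hBg
  obtain ⟨aT, haT, hTok⟩ := hTok
  intro a ha
  obtain ⟨c, c₀, c₁, B₃, aS, a₁, hB₃, haS, ha₁, h8⟩ := prop8StepCoPGridGBAt_holds F
  have ha₀ : 0 < min (min a aS) (min aU (min aB aT)) := lt_min (lt_min ha haS) (lt_min haU (lt_min haB haT))
  have ha₀a : min (min a aS) (min aU (min aB aT)) ≤ a := (min_le_left _ _).trans (min_le_left _ _)
  have ha₀S : min (min a aS) (min aU (min aB aT)) ≤ aS := (min_le_left _ _).trans (min_le_right _ _)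
  have ha₀U : min (min a aS) (min aU (min aB aT)) ≤ aU := (min_le_right _ _).trans (min_le_left _ _)
  have ha₀B : min (min a aS) (min aU (min aB aT)) ≤ aB := (min_le_right _ _).trans ((min_le_right _ _).trans (min_le_left _ _))
  have ha₀T : min (min a aS) (min aU (min aB aT)) ≤ aT := (min_le_right _ _).trans ((min_le_right _ _).trans (min_le_right _ _))
  generalize min (min a aS) (min aU (min aB aT)) = a₀ at ha₀ ha₀a ha₀S ha₀U ha₀B ha₀T
  have h8a := h8.of_le ha₀S le_rfl
  have hL : (0 : ℝ) < (F.L : ℝ) := by exact_mod_cast lt_trans Nat.zero_lt_one F.hL.2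
  have hBpos : (0 : ℝ) < B₃ := lt_of_lt_of_le (mul_pos two_pos (pow_pos hL 2)) hB₃
  obtain ⟨j, c', B₉, a₁', hcc', hc', hc₀, hc₁, hB₉, ha₁', ha₁'le, h9⟩ :=
    gauge9SupplierG3B_of_prop6MemberP F (twoPrimeAx F) (lamDatum F) (dataSmall7LamTopOf F 2) c c₀ c₁ B₃ a₀ a₁ hB₃ ha₀ ha₁ h8a
  have h15 : VariationalThm1RegSepCoP7MGB F 2 (fun ν M g K k _s => c' ≤ ν.M₁ ∧ k + c₀ ≤ F.m + K ∧ F.L ^ c₁ ∣ M ∧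
      ∀ i, 1 ≤ i → i ≤ k → dCubeSide (F.P K).L M (RkOfRecord (F.P K).L ν.r (g i)) i ∣ (F.P K).sitesPerDir 0) (lamDatum F) (dataSmall7LamTopOf F 2) B₃ a₀ a₁' :=
    (variationalThm1RegSepCoP7MGB_of_prop8TopStepGB_lamDatum hBpos (h8a.of_le le_rfl ha₁'le)).of_imp fun _ _ _ _ _ _ h => ⟨hcc'.trans h.1, h.2⟩
  obtain ⟨MU, hU⟩ := hUk B₃ a₀ a₁' hB₃ ha₀ ha₀U ha₁'
  obtain ⟨MB, hB⟩ := hBg a₀ ha₀ ha₀B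
  obtain ⟨MT, hT⟩ := hTok a₀ ha₀ ha₀T
  refine ⟨a₀, ha₀, ha₀a, fun Mth => ?_⟩
  have he : ∀ n : ℕ, n ≤ max Mth (max MU (max MB MT)) → n ≤ F.L ^ max Mth (max MU (max MB MT)) :=
    fun n hn => hn.trans (Nat.lt_pow_self F.hL.2).le
  have hG : McGuard F (F.L ^ max Mth (max MU (max MB MT))) := mcGuard_pow F _
  refine ⟨F.L ^ max Mth (max MU (max MB MT)), he Mth (le_max_left _ _), j, c', c₀, c₁, B₃, B₉, a₁', ?_⟩
  unfold JoinAntecedents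
  exact ⟨hG, hc', hc₀, hc₁, hB₃, hB₉, ha₀, ha₁', h15, h9,
    hU _ hG (he MU ((le_max_left _ _).trans (le_max_right _ _))),
    hB _ hG (he MB (((le_max_left _ _).trans (le_max_right _ _)).trans (le_max_right _ _))),
    hT _ hG (he MT (((le_max_right _ _).trans (le_max_right _ _)).trans (le_max_right _ _)))⟩

/-- Radius-first ⟹ ★ P3 g88's cofinal-radii shape (bookkeeping: read the radius, then the threshold). [cite: Balaban1987RG1, Thm 3 p.264 (bookkeeping)] -/
theorem joinAntecedentsCofinalRadii_of_radiusFirst {Tok : T4Family → ℕ → ℝ → Prop} {F : T4Family}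
    (h : ∀ a : ℝ, 0 < a → ∃ a₀ : ℝ, 0 < a₀ ∧ a₀ ≤ a ∧ ∀ Mth : ℕ, ∃ Mc : ℕ, Mth ≤ Mc ∧
      ∃ (j c c₀ c₁ : ℕ) (B₃ B₃' a₁ : ℝ), JoinAntecedents Tok F Mc j c c₀ c₁ B₃ B₃' a₀ a₁) :
    JoinAntecedentsCofinalRadii Tok F := by
  intro Mth a ha
  obtain ⟨a₀, ha₀, hle, hM⟩ := h a ha
  obtain ⟨Mc, hMc, hJ⟩ := hM Mth
  exact ⟨a₀, ha₀, hle, Mc, hMc, hJ⟩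

/-! ## §4  ★★ The junction's binder `hβc` ⟸ cofinal ⁸ ∧ the radius-first supply ∧ (C-orb)♭ ∧ the two window letters -/

/-- ★★ **THE JUNCTION's BINDER `hβc` VERBATIM — `∀ F a, 0 < a → CofinalBetaSocketAxBody F a` — FROM THE COFINAL ⁸ + THE RADIUS-FIRST SUPPLY + (C-orb)♭ + THE HESSIAN ROW AND THE SIGN LETTER
IN THE WINDOW** (№17 §2 ✓`cofinalBetaSocketAxBody_allRadii_of_sig8LR4BoxCofinal_antecedents_orb_window` with `JoinAntecedentsCofinal` WEAKENED to the radius-first cofinal-radii supply): for the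
ceiling `a`, read the supplied radius `a₀ ≤ a`; the window `(εw, γw)` at `a₀`; ⁸-below at `εw` gives a threshold `Mth`; the supply at `Mth` gives `Mc ≥ Mth` and the thirteen antecedents at `a₀`;
⁸-below yields D1 at every box history of some level `γ₀` with `ε₂₉ ≤ εw`; rows by ✓`chartRowsBox_of_orbit` ((C-orb)♭ + antecedent (12)); the letters at `(ε₂₉, min γ₀ (min γw ½))` INSIDE the
window; ✓№10 `cofinalBetaSocketAxBody_of_chartRowsBox_hessBox_negPart` at radius `a₀ ≤ a`, `Mg := 4·Mc` (D1 restricted by `mem_box`).  CONDITIONAL; every hypothesis OPEN; the junction's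
consumer, K0ᴬ 27238, K1ᴬ 27239 remain OPEN; NODE O 0∕1; the Yang–Mills mass gap is NOT proved.
[cite: Balaban1987RG1, Thm 2 (0.31) p.259, Thm 3 p.264, (1.18)–(1.22) pp.263–264, (5.38)–(5.44) pp.296–297; Balaban1985Variational, Thm 1 p.279, Prop. 9 p.309, (176)–(178) p.306] -/
theorem cofinalBetaSocketAxBody_allRadii_of_sig8LR4BoxCofinal_radiusFirst_orb_window (Tok : T4Family → ℕ → ℝ → Prop)
    (hBr : ∀ (F : T4Family) (Mc : ℕ) (a₀ : ℝ), Tok F Mc a₀ → TokP9L4Old F Mc a₀)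
    (h8c : ∀ (F : T4Family) (εw : ℝ), 0 < εw → Sig8LR4BoxBelow F εw)
    (hA : ∀ (F : T4Family) (a : ℝ), 0 < a → ∃ a₀ : ℝ, 0 < a₀ ∧ a₀ ≤ a ∧ ∀ Mth : ℕ, ∃ Mc : ℕ, Mth ≤ Mc ∧
      ∃ (j c c₀ c₁ : ℕ) (B₃ B₃' a₁ : ℝ), JoinAntecedents Tok F Mc j c c₀ c₁ B₃ B₃' a₀ a₁)
    (hOrb : ∀ (F : T4Family) (Mc : ℕ) (a₀ ε₂₉ : ℝ), McGuard F Mc → 0 < a₀ → 0 < ε₂₉ →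
      letI θ := thetaFill F a₀ ε₂₉; letI := θ.instVβ₁; letI := θ.instVβ₂; letI := θ.instιβ;
      (∀ (k n : ℕ) (a : θ.ιβ) (l : RespLabel F k (recordK₀ F Mc k + n)), RootedResponseOrbitAt F θ k (recordK₀ F Mc k + n) a l))
    (hWin : ∀ (F : T4Family) (a₀ : ℝ), 0 < a₀ → ∃ εw γw : ℝ, 0 < εw ∧ 0 < γw ∧ ∀ (ε₂₉ γ₀ : ℝ), 0 < ε₂₉ → ε₂₉ ≤ εw → 0 < γ₀ → γ₀ ≤ γw → γ₀ ≤ 1 / 2 →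
      (letI θ := thetaFill F a₀ ε₂₉; letI := θ.instVβ₁; letI := θ.instVβ₂; letI := θ.instιβ;
       (∀ k K : ℕ, ContinuousOn (fun v : Fin (k + 1) → ℝ => fderiv ℝ (fderiv ℝ (B12PolarizationTensor120.expChart (recordTermsAx F a₀ ε₂₉ k v K) θ.ρ8)) 0) (FlowStep.Box γ₀ k))) ∧ ∃ e : ℕ → ℝ, RecordPlimMomentNegPartOnBoxAx F a₀ ε₂₉ γ₀ e) :
    ∀ F : T4Family, ∀ a : ℝ, 0 < a → CofinalBetaSocketAxBody F a := by
  intro F a ha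
  obtain ⟨a₀, ha₀', hle, hAM⟩ := hA F a ha
  obtain ⟨εw, γw, hεw, hγw, hW⟩ := hWin F a₀ ha₀'
  obtain ⟨Mth, h8F⟩ := h8c F εw hεw
  obtain ⟨Mc, hMc, j, c, c₀, c₁, B₃, B₃', a₁, hAnt⟩ := hAM Mth
  obtain ⟨hG0, hc, hc₀, hc₁, hB₃, hB₃', ha₀, ha₁, hThm, hGauge, hUk, hBg, hP9⟩ := hAnt
  obtain ⟨γ₀, ε₂₉, E₀, κ, α₀, α₁, hγ₀, hε, hεle, hE₀, hκ, hα₀, hα₁, hD⟩ :=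
    h8F Mc hMc j c c₀ c₁ B₃ B₃' a₀ a₁ hG0 hc hc₀ hc₁ hB₃ hB₃' ha₀ ha₁ hThm hGauge hUk hBg (hBr F Mc a₀ hP9)
  letI θ := thetaFill F a₀ ε₂₉; letI := θ.instVβ₁; letI := θ.instVβ₂; letI := θ.instιβ
  obtain ⟨ιC, hsw, h9⟩ := chartRowsBox_of_orbit F Mc a₀ ε₂₉ ha₀ (hOrb F Mc a₀ ε₂₉ hG0 ha₀ hε) fun k n => (hBg k n ε₂₉ hε).contDiffAt
  -- ⁸'s level shrunk into the window
  have hγ₁ : 0 < min γ₀ (min γw (1 / 2)) := lt_min hγ₀ (lt_min hγw (by norm_num))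
  have hγw' : min γ₀ (min γw (1 / 2)) ≤ γw := (min_le_right _ _).trans (min_le_left _ _)
  have hγh : min γ₀ (min γw (1 / 2)) ≤ 1 / 2 := (min_le_right _ _).trans (min_le_right _ _)
  obtain ⟨hH, e, hneg⟩ := hW ε₂₉ (min γ₀ (min γw (1 / 2))) hε hεle hγ₁ hγw' hγh
  refine cofinalBetaSocketAxBody_of_chartRowsBox_hessBox_negPart (Mg := 4 * (Mc : ℝ)) hE₀ hκ F a₀ ε₂₉ (min γ₀ (min γw (1 / 2))) α₀ α₁ ha₀ hle hγ₁ hγh hε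
    hα₀ hα₁ Mc hG0 le_rfl ιC (fun k v hv => hD k v ?_) hsw h9 hH hneg
  exact mem_box.mpr fun i => ⟨(mem_box.mp hv i).1, (mem_box.mp hv i).2.trans (min_le_left _ _)⟩

/-! ## §5  ★★★ The junction's binder `hβc` ⟸ cofinal ⁸ ∧ (R-Uk) ∧ (R-Bg) ∧ (R-Tok) ∧ (C-orb)♭ ∧ the two window letters -/

/-- ★★★ **THE JUNCTION's BINDER `hβc` FROM THE COFINAL ⁸ + THE THREE RESIDUAL RECEIPTS + (C-orb)♭ + THE TWO WINDOW LETTERS** (§4 ∘ §3): NET (LENS P3, box road): the junction's displayed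
residue = {cofinal ⁸ `∀ εw > 0, Sig8LR4BoxBelow F εw`, (R-Uk), (R-Bg), (R-Tok), (C-orb)♭} + {Hessian row, sign letter} in the window `(0, εw(F,a₀)] × (0, min(γw, ½)]` — `JoinAntecedentsCofinal`
(thirteen rows, inhabited nowhere) OFF the display, ten of its rows being tree theorems.  CONDITIONAL; every hypothesis OPEN Bałaban-strength content; the junction's consumer, K0ᴬ, K1ᴬ, K3ᴬ
remain OPEN; NODE O 0∕1; COUNT 8∕28 · K 1∕4 unmoved; the Yang–Mills mass gap is NOT proved.
[cite: Balaban1987RG1, Thm 2 (0.31) p.259, Thm 3 p.264, (1.18)–(1.22) pp.263–264, (4.35) p.290, (5.38)–(5.44) pp.296–297; Balaban1985Variational, Thm 1 (8)–(9) p.279, Prop. 6 p.295,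
Prop. 9 p.309, (176)–(178) p.306] -/
theorem cofinalBetaSocketAxBody_allRadii_of_sig8LR4BoxCofinal_residual_orb_window (Tok : T4Family → ℕ → ℝ → Prop)
    (hBr : ∀ (F : T4Family) (Mc : ℕ) (a₀ : ℝ), Tok F Mc a₀ → TokP9L4Old F Mc a₀)
    (h8c : ∀ (F : T4Family) (εw : ℝ), 0 < εw → Sig8LR4BoxBelow F εw)
    (hUk : ∀ F : T4Family, ∃ aU : ℝ, 0 < aU ∧ ∀ (B₃ a₀ a₁ : ℝ), 2 * (F.L : ℝ) ^ 2 ≤ B₃ → 0 < a₀ → a₀ ≤ aU → 0 < a₁ → ∃ M₀ : ℕ, ∀ Mc : ℕ, McGuard F Mc → M₀ ≤ Mc →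
      (∀ ε₁ : ℝ, 0 < ε₁ → ε₁ ≤ a₁ → B₃ * ε₁ ≤ a₀ → ∀ (k n : ℕ) (V : Literature.MathematicalPhysics.QuantumFieldTheory.Balaban1983to89.GaugeField (F.P (Summit.QuantumFields.YangMills.Theorems.K0RecordFormatNames.recordK₀ F Mc k + n)) (k + 1) (Literature.MathematicalPhysics.QuantumFieldTheory.Balaban1983to89.Node00.SU 2)), Literature.MathematicalPhysics.QuantumFieldTheory.Balaban1983to89.PlaqSmall ε₁ V → Literature.MathematicalPhysics.QuantumFieldTheory.Balaban1983to89.Node00.UkExists F 2 (Summit.QuantumFields.YangMills.Theorems.K0RecordFormatNames.recordK₀ F Mc k + n) (k + 1) a₀ V ∧ Literature.MathematicalPhysics.QuantumFieldTheory.Balaban1983to89.Node00.UniqueUkOrbit F 2 (Summit.QuantumFields.YangMills.Theorems.K0RecordFormatNames.recordK₀ F Mc k + n) (k + 1) a₀ V))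
    (hBg : ∀ F : T4Family, ∃ aB : ℝ, 0 < aB ∧ ∀ a₀ : ℝ, 0 < a₀ → a₀ ≤ aB → ∃ M₀ : ℕ, ∀ Mc : ℕ, McGuard F Mc → M₀ ≤ Mc →
      (∀ (k n : ℕ) (ε₂₉ : ℝ), 0 < ε₂₉ → letI θ := Summit.QuantumFields.YangMills.Theorems.K0RecordFormatNames.thetaFill F a₀ ε₂₉; letI := θ.instVβ₁; letI := θ.instVβ₂; letI := θ.instιβ; AnalyticAt ℝ (fun B : Summit.QuantumFields.YangMills.Theorems.K0RecordFormatNames.recordW F a₀ ε₂₉ k (Summit.QuantumFields.YangMills.Theorems.K0RecordFormatNames.recordK₀ F Mc k + n) => fun (b : Literature.MathematicalPhysics.QuantumFieldTheory.Balaban1983to89.PBond (F.P (Summit.QuantumFields.YangMills.Theorems.K0RecordFormatNames.recordK₀ F Mc k + n)) 0) (i i' : Fin 2) => ((Summit.QuantumFields.YangMills.Theorems.K0RecordFormatNames.recordBgField F θ k (Summit.QuantumFields.YangMills.Theorems.K0RecordFormatNames.recordK₀ F Mc k + n) B b : Literature.MathematicalPhysics.QuantumFieldTheory.Balaban1983to89.Node00.SU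 2) : Matrix (Fin 2) (Fin 2) ℂ) i i') 0))
    (hTok : ∀ F : T4Family, ∃ aT : ℝ, 0 < aT ∧ ∀ a₀ : ℝ, 0 < a₀ → a₀ ≤ aT → ∃ M₀ : ℕ, ∀ Mc : ℕ, McGuard F Mc → M₀ ≤ Mc → Tok F Mc a₀)
    (hOrb : ∀ (F : T4Family) (Mc : ℕ) (a₀ ε₂₉ : ℝ), McGuard F Mc → 0 < a₀ → 0 < ε₂₉ →
      letI θ := thetaFill F a₀ ε₂₉; letI := θ.instVβ₁; letI := θ.instVβ₂; letI := θ.instιβ;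
      (∀ (k n : ℕ) (a : θ.ιβ) (l : RespLabel F k (recordK₀ F Mc k + n)), RootedResponseOrbitAt F θ k (recordK₀ F Mc k + n) a l))
    (hWin : ∀ (F : T4Family) (a₀ : ℝ), 0 < a₀ → ∃ εw γw : ℝ, 0 < εw ∧ 0 < γw ∧ ∀ (ε₂₉ γ₀ : ℝ), 0 < ε₂₉ → ε₂₉ ≤ εw → 0 < γ₀ → γ₀ ≤ γw → γ₀ ≤ 1 / 2 →
      (letI θ := thetaFill F a₀ ε₂₉; letI := θ.instVβ₁; letI := θ.instVβ₂; letI := θ.instιβ;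
       (∀ k K : ℕ, ContinuousOn (fun v : Fin (k + 1) → ℝ => fderiv ℝ (fderiv ℝ (B12PolarizationTensor120.expChart (recordTermsAx F a₀ ε₂₉ k v K) θ.ρ8)) 0) (FlowStep.Box γ₀ k))) ∧ ∃ e : ℕ → ℝ, RecordPlimMomentNegPartOnBoxAx F a₀ ε₂₉ γ₀ e) :
    ∀ F : T4Family, ∀ a : ℝ, 0 < a → CofinalBetaSocketAxBody F a :=
  cofinalBetaSocketAxBody_allRadii_of_sig8LR4BoxCofinal_radiusFirst_orb_window Tok hBr h8c
    (fun F => joinAntecedentsRadiusFirst_of_residual Tok F (hUk F) (hBg F) (hTok F)) hOrb hWin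

-- standard axioms only
#print axioms record13SepCoPHInhabitedAx_of_sig8LR4Box_antecedentsCofinalRadii_orb
#print axioms record13SepCoPHInhabitedAx_of_sig8LR4Box_residual_orb
#print axioms joinAntecedentsRadiusFirst_of_residual
#print axioms joinAntecedentsCofinalRadii_of_radiusFirst
#print axioms cofinalBetaSocketAxBody_allRadii_of_sig8LR4BoxCofinal_radiusFirst_orb_window
#print axioms cofinalBetaSocketAxBody_allRadii_of_sig8LR4BoxCofinal_residual_orb_window

end Summit.QuantumFields.YangMills.Theorems.K0AxJoinResidualBox
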